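import Literature.MathematicalPhysics.QuantumFieldTheory.Balaban1983to89.B6Prop22KLevelCensus
import Literature.MathematicalPhysics.QuantumFieldTheory.Balaban1983to89.B6Prop22SixMultiLevelBox

/-!
# `Balaban1983to89.B6Prop22KLevelCensusEta` — [B6] PROPOSITION 2.2 IN THE CENSUS TYPING ON THE GENUINE `k`-LEVEL FAMILY
# `KIdx` MEASURED IN PRINT'S UNITS `η = L^{−k}` (so that `L^kη = 1`: the coarsest blocks are unit cubes, as in print), AND
# ITS HÖLDER CONJUNCT AT EACH `α` — all six entries of (2.67), per `α`, on EVERY nested family (2.1)–(2.2) of the box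

statement-level skeleton of published theorems with citation tags; proofs where landed; nothing here is a claim about the Yang–Mills mass gap

T. Bałaban, *Propagators and renormalization transformations for lattice gauge theories. II*, Commun. Math. Phys. **96**
(1984) 223–250 [Balaban1984PropagatorsII].  PDF held `paper:balaban1984-cmp96-propagators-rt-ii` (journal page = PDF page
+ 222): p. 234 [PDF 12] (Prop. 2.2, (2.67)), p. 224 [PDF 2] ((2.1)–(2.2), the lattices `T_η ⊃ T^{(j)}_{L^jη}`), p. 231
[PDF 9] ((2.46)); [Balaban1984PropagatorsI] (1.109) p. 35 (the Hölder norm); [Balaban1983RegularityDecay] Thm (1.9) p. 573.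

CITATION HEADER (lean-in-tree rule).  Cell `lit-balaban` (HOME `run/shared/lean/pub/lit-balaban/`), unit `lit-balaban-r03`
gen 13 (B6 fold owner, own lane), SKELETON row **B6.Prop2.2**.  Consumed BY NAME: gen 12's `k`-level census dictionary
`…B6Prop22KLevelCensus` (`KIdx`, `KIdx.geo`, `KIdx.gp`, `prop22_supEntries_kLevel` p320391, `kLevel_nonvacuous`) and p21
g11's six-entry package for the genuine `k`-level operator `…B6Prop22SixMultiLevelBox` (`prop22_six_multiLevelBox`,
`prop22_six_pointwise_multiLevelBox`, p323679).  Nothing existing is modified or restated; no `def … : Prop` fact; the new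
definitions are a RESCALING DICTIONARY (`geoP`, `gpP`) — the same members, the same operator, lengths in print's units.

WHY THIS FILE (units).  `…B6Prop22KLevelCensus` types the `k`-level family in the LATTICE units of p21's lineage (`η = 1`,
`L^jη ↦ L^j`, `KIdx.geo.len y = L^j`, `KIdx.hq` = the lattice Hölder seminorm).  For the four SUP entries of (2.67) this is an
exact transcription (G′^η = η²·G′^{lat}, ∇^η = η^{−1}∇^{lat}: `|G′λ| ≤ C(L^jη)²…` ⇔ `|G′^{lat}λ| ≤ CL^{2j}…`, etc.), and gen 12's
`prop22_supEntries_kLevel` is the first conjunct of `B6.Prop22Printed` on it.  For the HÖLDER entries it is NOT: print's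
`‖ζ∇^ηG′^ηλ‖^η_α ≤ O(1)(L^jη)^{1−α}(‖ζ‖^η_α + |ζ|)e^{−½δ₀d}|λ|` reads, in lattice units, `‖ζ∇G′λ‖^{lat}_α ≤ O(1)(L^j)^{1−α}
(L^{kα}‖ζ‖^{lat}_α + |ζ|)e^{−½δ₀d}|λ|` (`‖·‖^η_α = η^{−α}‖·‖^{lat}_α`, `η = L^{−k}`), whereas the census sentence evaluated on
`(KIdx.geo, KIdx.gp)` would demand `… (L^j)^{1−α}(‖ζ‖^{lat}_α + |ζ|) …` — stronger than print by the factor `L^{kα}` on the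
`‖ζ‖_α` term, and not what the product rule `‖ζF‖_α ≤ ‖ζ‖_α·sup|F| + |ζ|·‖F‖_α` gives from the entries `sup|∇G′λ| = O(L^j)`,
`‖∇G′λ‖_α = O((L^j)^{1−α})` (print's derivation uses `L^jη ≤ 1`).  So the HÖLDER conjunct of the census Prop on the
`k`-level family must be taken in print's units; this file provides that family (`geoP`/`gpP`: `η := L^{−k}`, `len y =
L^jη = L^{j−k} ≤ 1`, `‖f‖_α` with `|x′−x|_∞·η`, `G′ := η²·gml`, `∇^η`, `∇^{η*}`) — the exact analogue of gen 12's two-level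
`TLIdx` dictionary (`…B6Prop22TwoLevelCensus`, `ξ = L^{−k}`) — and proves on it BOTH conjuncts of `B6.Prop22Printed` at
every fixed `α` (order `∀ α ∃ (M₁, δ₀, C, C_α)`; the census order `∃ (M₁, δ₀) ∀ α` needs the `_unif` re-threading of p21's
`k`-level Hölder chain, as done for two levels in `…B6Prop22TwoLevelCensusUnif`).

WHAT IS PRINTED (p. 234): «**Proposition 2.2.** If we have (2.1), (2.2) and M is sufficiently large, then the operator
G′ = Δ′_a^{−1} (a = 1) satisfies the inequalities |(G′λ)(x)|, |(∇G′λ)(x)|, |(G′∇*λ)(x)|, ‖ζ∇G′λ‖_α, ‖ζG′∇*λ‖_α, |(ΔG′λ)(x)|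
≤ O(1)[(L^jη)², L^jη, L^jη, (L^jη)^{1−α}(‖ζ‖_α + |ζ|), (L^jη)^{1−α}(‖ζ‖_α + |ζ|), 1]e^{−½δ₀d(y,y′)}|λ|, x ∈ B^j(y) or supp ζ ⊂
B^j(y), y ∈ Λ_j, supp λ ⊂ B^{j′}(y′), y′ ∈ Λ_{j′}. (2.67)».

WHAT THIS FILE PROVES (kernel-checked; 0 sorry):
* §1 the print-unit dictionary on `KIdx`: `nK = L^k`, `hqP`/`hqBP` (Hölder seminorms with `|x′−x| = |x′−x|_∞/L^k`), `dG`
  (`∇^η_μG′^ηλ = η·∇^{lat}_μ(gml λ)`), `Gd` (`G′^η∇^{η*}_μλ = η·(gml ∂_μᵀλ)`), `hHP`, `geoP` (`KIdx.geo` with `eta := L^{−k}`,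
  `holder := hqP`, `cutH := hqP + |·|`), `gpP` (entries `η²e₀, ηe₁, ηe₂, e₃`, Hölder slot `hHP`); `geoP_len`, `len_le_one`.
* §2 `prop22_supEntries_kLevelP` — the FIRST CONJUNCT of `B6.Prop22Printed (geoP) (gpP)` (∀ m : Fin 4), from gen 12's
  `prop22_supEntries_kLevel` by the exact rescaling `pref4 (L^jη) m = η^{(2,1,1,0)_m}·pref4 (L^j) m`.
* §3 Hölder plumbing in print's units (`hqP_nonneg`, `pair_le_hqP`, `quot_eq_abs_weightP`, `hqP_le_of_forall`,
  `hqBP_le_of_forall`, `hHP_le_of_forall`, the product rule `holder_pair_boundP`; `supF_nonneg`/`abs_le_supF` private — same shape as the `TLIdx` ones).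
* §4 **`prop22_holderEntries_kLevelP`** — THE HÖLDER CONJUNCT AT EACH `0 ≤ α < 1` on the genuine `k`-level family in
  print's units: `∃ M₁ δ₀ C > 0 ∀ i, M₁ ≤ M → ∀ λ ζ y y′ (supp ζ ⊂ B(y), supp λ ⊂ B(y′)): max_μ max(‖ζ∇^η_μG′λ‖_α,
  ‖ζG′∇^{η*}_μλ‖_α) ≤ C·(L^jη)^{1−α}·(‖ζ‖_α + |ζ|)·e^{−½δ₀d(y,y′)}·|λ|` — from p21's `prop22_six_multiLevelBox` (entries 2, 3:
  `sup_{B(y)}` of `F`) and `prop22_six_pointwise_multiLevelBox` (entries 4, 5 on the pairs of one block) by the product rule,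
  using `L^jη ≤ 1` exactly where print does.
* §5 **`prop22Printed_kLevelP_perAlpha`** — BOTH CONJUNCTS of the census sentence of Prop. 2.2 AT EACH `α` on the genuine
  `k`-level family in print's units (∀ α ∈ [0,1) ∃ M₁ δ₀ C C_α …), and `kLevelP_nonvacuous` (members with `M ≥` any
  threshold and the two top levels present, gen 12's witness).
HONEST SCOPE.  (1) Quantifier order `∀ α ∃ …`, not the census `∃ M₁ δ₀ ∀ α` (that is the `_unif` re-threading of p21's
`k`-level chain — not in the tree).  (2) The family is `…B6Prop22KLevelCensus`'s: ALL nested block-union families (2.1)–(2.2)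
of the Neumann box `Ω₁ = … = Ω_k = X` (print admits equal domains; the torus is not treated), levels `1 … k` (print `0 … k`),
`A = 0`, `m² = 0`, printed weights `a = 1`, reading R2 of (2.46) (p21's realised distance), entries 3/5 per component `μ`,
forward differences along bonds of the box, constants existential (depend on `d`, `L`; `C_α` also on `α`).  (3) `η = L^{−k}`
normalises the COARSEST blocks to unit size (print: `T^{(k)}_1` is the unit lattice); any other normalisation `η ≤ L^{−k}`
gives the same sentence with the same constants (all prefactors are monomials in `L^jη ≤ 1`).  NOT summit progress.
-/

noncomputable section

open scoped BigOperators
open Finset Matrix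

namespace Literature.MathematicalPhysics.QuantumFieldTheory.Balaban1983to89.B6Prop22KLevelCensusEta

open Literature.MathematicalPhysics.QuantumFieldTheory.Balaban1983to89.B4ContourShift (supNorm abs_le_supNorm supNorm_nonneg)
open Literature.MathematicalPhysics.QuantumFieldTheory.Balaban1983to89.B4Reflection242 (boxDom mem_boxDom)
open Literature.MathematicalPhysics.QuantumFieldTheory.Balaban1983to89.B4Lemma22ZeroBoxDerivDual (fwd fwd_val_of_mem
  fwd_of_not_mem)
open Literature.MathematicalPhysics.QuantumFieldTheory.Balaban1983to89.B6MultiLevelBoxOperator (N0 Domains aPrinted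
  aPrinted_window aPrinted_succ gml)
open Literature.MathematicalPhysics.QuantumFieldTheory.Balaban1983to89.B6Geom246MultiLevelBox (bset blkOf geom bond
  scale_bounds lev_eq_of_blkOf_eq)
open Literature.MathematicalPhysics.QuantumFieldTheory.Balaban1983to89.B6Ineq243TwoLevelBox (aNext)
open Literature.MathematicalPhysics.QuantumFieldTheory.Balaban1983to89.B6Ineq243AdjTwoLevelBox (dstar dstar_apply)
open Literature.MathematicalPhysics.QuantumFieldTheory.Balaban1983to89.B6Prop22DerivMultiLevelBox (dMat dMat_mulVec_of_mem
  dMat_mulVec_of_not_mem)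
open Literature.MathematicalPhysics.QuantumFieldTheory.Balaban1983to89.B6RandomWalk (HasMajorant BlockSupp)
open Literature.MathematicalPhysics.QuantumFieldTheory.Balaban1983to89.B6Prop22SixMultiLevelBox (prop22_six_multiLevelBox
  prop22_six_pointwise_multiLevelBox)
open Literature.MathematicalPhysics.QuantumFieldTheory.Balaban1983to89.B6Prop22KLevelCensus (KIdx prop22_supEntries_kLevel
  kLevel_nonvacuous)
open Literature.MathematicalPhysics.QuantumFieldTheory.Balaban1983to89.B6 (Geometry GpFamily Prop22Printed pref4)

variable {d : ℕ}

/-! ## §1 The print-unit dictionary on the `k`-level family -/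

section Dictionary

variable {ℓ : ℕ} (i : KIdx d ℓ)

/-- `n = L^k`: the number of fine sites per coarsest block side; print's `η = L^{−k}` in units where the coarsest blocks
(level `k`) are unit cubes (`L^kη = 1`). [cite: Balaban1984PropagatorsII, (2.1) p.224 (the lattices `T^{(j)}_{L^jη}`), dictionary] -/
def nK : ℕ := (ℓ + 1) ^ i.k

/-- `1 ≤ L^k`. [cite: Balaban1984PropagatorsII, (2.1) p.224, dictionary] -/
theorem one_le_nK : 1 ≤ nK i := Nat.one_le_pow _ _ (by omega)

/-- `0 < L^k` (as a real). [cite: Balaban1984PropagatorsII, (2.1) p.224, dictionary] -/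
theorem nK_pos : (0 : ℝ) < ((nK i : ℕ) : ℝ) := by exact_mod_cast lt_of_lt_of_le Nat.one_pos (one_le_nK i)

open Classical in
/-- the Hölder seminorm in print's units: `‖f‖_α = sup_{x ≠ x′} |f(x′) − f(x)|/(η|x′ − x|_∞)^α`, `η = L^{−k}`.
[cite: Balaban1984PropagatorsII, Prop. 2.2 (2.67) p.234 («‖ζ‖_α»); Balaban1984PropagatorsI, (1.109) p.35] -/
def hqP (α : ℝ) (f : ↥(i.XB) → ℝ) : ℝ :=
  ⨆ p : ↥(i.XB) × ↥(i.XB), if p.1 ≠ p.2 then |f p.2 - f p.1| / (supNorm (p.2.1 - p.1.1) / (nK i)) ^ α else 0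

open Classical in
/-- the Hölder seminorm (print's units) of a `μ`-bond function over pairs of sites which both carry a `μ`-bond of the box.
[cite: Balaban1984PropagatorsII, Prop. 2.2 (2.67) p.234 («‖ζ∇G′λ‖_α»), dictionary] -/
def hqBP (μ : Fin (d + 1)) (α : ℝ) (f : ↥(i.XB) → ℝ) : ℝ :=
  ⨆ p : ↥(i.XB) × ↥(i.XB), if p.1 ≠ p.2 ∧ p.1.1 + Pi.single μ 1 ∈ i.XB ∧ p.2.1 + Pi.single μ 1 ∈ i.XB then
    |f p.2 - f p.1| / (supNorm (p.2.1 - p.1.1) / (nK i)) ^ α else 0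

/-- `(∇^η_μG′λ)(x)` in print's units: `G′ = (Δ′^η_a)⁻¹ = η²·gml`, `∇^η = η⁻¹∇^{lat}`, so `∇^η_μG′λ = η·((gml λ)(x+e_μ) − (gml λ)(x))`.
[cite: Balaban1984PropagatorsII, Prop. 2.2 (2.67) p.234 (the entry ∇G′λ), (2.13) p.225, dictionary] -/
def dG (μ : Fin (d + 1)) (f : ↥(i.XB) → ℝ) (x : ↥(i.XB)) : ℝ :=
  (((nK i : ℕ) : ℝ))⁻¹ * ((i.G *ᵥ f) (fwd i.NB μ x) - (i.G *ᵥ f) x)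

/-- `(G′∇^{η*}_μλ)(x)` in print's units: `G′∇^{η*}_μ = η²·gml·η⁻¹∂_μᵀ = η·(gml ∂_μᵀ)` (`dstar 1 μ gml = gml·∂_μᵀ`).
[cite: Balaban1984PropagatorsII, Prop. 2.2 (2.67) p.234 (the entry G′∇*λ), dictionary] -/
def Gd (μ : Fin (d + 1)) (f : ↥(i.XB) → ℝ) (x : ↥(i.XB)) : ℝ :=
  (((nK i : ℕ) : ℝ))⁻¹ * (dstar 1 μ i.G *ᵥ f) x

open Classical in
/-- the Hölder entries (2.67)₄,₅ in print's units: `max_μ max(‖ζ∇^η_μG′λ‖_α, ‖ζG′∇^{η*}_μλ‖_α)` (bond pairs for the bond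
function, site pairs for the site function). [cite: Balaban1984PropagatorsII, Prop. 2.2 (2.67) p.234] -/
def hHP (f : ↥(i.XB) → ℝ) (α : ℝ) (ζ : ↥(i.XB) → ℝ) : ℝ :=
  ⨆ p : Fin (d + 1) × Bool, if p.2 then hqBP i p.1 α (fun x => ζ x * dG i p.1 f x)
    else hqP i α (fun x => ζ x * Gd i p.1 f x)

/-- **THE CENSUS GEOMETRY OF THE MEMBER IN PRINT'S UNITS**: gen 12's `KIdx.geo` (p21's realised geometry `geom D`, `M = L·M_h`,
`R`, the localisation vocabulary) with `η := L^{−k}` (so `len y = L^jη = L^{j−k}`) and the Hölder vocabulary `‖·‖_α = hqP`,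
`‖ζ‖_α + |ζ| = hqP + supF`. [cite: Balaban1984PropagatorsII, (2.1)–(2.2) p.224, (2.46) p.231, Prop. 2.2 (2.67) p.234] -/
def geoP : Geometry :=
  { i.geo with
    eta := (((nK i : ℕ) : ℝ))⁻¹
    holder := hqP i
    cutH := fun α ζ => hqP i α ζ + i.supF ζ }

/-- the powers of `η` carried by the four sup entries: `G′ ↦ η²`, `∇G′ ↦ η`, `G′∇* ↦ η`, `ΔG′ ↦ 1`.
[cite: Balaban1984PropagatorsII, (2.67) p.234 (prefactors [(L^jη)², L^jη, L^jη, 1]), dictionary] -/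
def epow : Fin 4 → ℕ := ![2, 1, 1, 0]

/-- **THE (2.67) FUNCTIONALS OF `G′` ON THE MEMBER IN PRINT'S UNITS**: the sup entries of `KIdx.gp` rescaled by
`η^{(2,1,1,0)}` (`G′ = η²gml`, `∇^η = η⁻¹∇`, `Δ^η = η⁻²Δ`), the Hölder slot `hHP`. [cite: Balaban1984PropagatorsII, Prop. 2.2 (2.67) p.234] -/
def gpP : GpFamily (geoP i) where
  e := fun m f s => ((((nK i : ℕ) : ℝ))⁻¹) ^ (epow m) * i.gp.e m f s
  h1 := hHP i

/-- `(geoP i).len y = L^j·η = L^j/L^k`. [cite: Balaban1984PropagatorsII, (2.1) p.224 («L^jη»), dictionary] -/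
theorem geoP_len (s : ↥(bset i.D)) : (geoP i).len s = ((ℓ : ℝ) + 1) ^ s.1.1 * (((nK i : ℕ) : ℝ))⁻¹ := rfl

/-- `0 < L^jη`. [cite: Balaban1984PropagatorsII, (2.1) p.224, dictionary] -/
theorem len_pos (s : ↥(bset i.D)) : 0 < (geoP i).len s := by
  rw [geoP_len]; exact mul_pos (by positivity) (inv_pos.2 (nK_pos i))

/-- `L^jη ≤ 1` — the blocks of every level are at most unit size in print's units (`j ≤ k`).
[cite: Balaban1984PropagatorsII, (2.1) p.224 («T^{(j)}_{L^jη}», j ≤ k), dictionary] -/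
theorem len_le_one (s : ↥(bset i.D)) : (geoP i).len s ≤ 1 := by
  rw [geoP_len]
  have hn := nK_pos i
  rw [mul_inv_le_iff₀ hn, one_mul]
  have hj : s.1.1 ≤ i.k := (scale_bounds i.D s).2
  have : ((ℓ : ℝ) + 1) ^ s.1.1 ≤ ((ℓ : ℝ) + 1) ^ i.k :=
    pow_le_pow_right₀ (by have : (0 : ℝ) ≤ ℓ := Nat.cast_nonneg _; linarith) hj
  refine this.trans (le_of_eq ?_)
  simp [nK]

/-- the sup entries of `gpP` are the rescaled lattice entries. [cite: Balaban1984PropagatorsII, (2.67) p.234, dictionary] -/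
theorem gpP_e (m : Fin 4) (f : ↥(i.XB) → ℝ) (s : ↥(bset i.D)) :
    (gpP i).e m f s = ((((nK i : ℕ) : ℝ))⁻¹) ^ (epow m) * i.gp.e m f s := rfl

/-- the Hölder slot of `gpP` is `hHP`. [cite: Balaban1984PropagatorsII, (2.67) p.234, dictionary] -/
theorem gpP_h1 : (gpP i).h1 = hHP i := rfl

/-- the prefactors rescale exactly: `pref4 (L^j·η) m = η^{(2,1,1,0)_m}·pref4 (L^j) m`. [cite: Balaban1984PropagatorsII, (2.67) p.234, dictionary] -/
theorem pref4_rescale (t η : ℝ) (m : Fin 4) : pref4 (t * η) m = η ^ (epow m) * pref4 t m := by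
  fin_cases m <;> simp [pref4, epow] <;> ring

/-- `0 ≤ |λ|`. [cite: Balaban1984PropagatorsII, Prop. 2.2 (2.67) p.234 («|λ|»), dictionary] -/
private theorem supF_nonneg (f : ↥(i.XB) → ℝ) : 0 ≤ i.supF f := by
  unfold KIdx.supF
  exact le_ciSup_of_le (Set.finite_range _).bddAbove i.origin (abs_nonneg _)

/-- `|λ(x)| ≤ |λ|`. [cite: Balaban1984PropagatorsII, Prop. 2.2 (2.67) p.234 («|λ|»), dictionary] -/
private theorem abs_le_supF (f : ↥(i.XB) → ℝ) (x : ↥(i.XB)) : |f x| ≤ i.supF f :=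
  le_ciSup (Set.finite_range fun x : ↥(i.XB) => |f x|).bddAbove x

end Dictionary

/-! ## §2 The sup conjunct in print's units (rescaling of gen 12's `prop22_supEntries_kLevel`) -/

/-- **THE FIRST CONJUNCT OF `B6.Prop22Printed` ON THE GENUINE `k`-LEVEL FAMILY IN PRINT'S UNITS**: `∃ M₁ δ₀ C > 0 ∀ i,
M₁ ≤ M → ∀ m λ y y′ (supp λ ⊂ B(y′)): e_m λ y ≤ C·[(L^jη)², L^jη, L^jη, 1]_m·e^{−½δ₀d(y,y′)}·|λ|` — gen 12's
`prop22_supEntries_kLevel` (lattice units) multiplied through by `η^{(2,1,1,0)_m}`; same constants.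
[cite: Balaban1984PropagatorsII, Prop. 2.2 (2.67) p.234 (entries 1, 2, 3, 6); (2.46) p.231] -/
theorem prop22_supEntries_kLevelP (d ℓ : ℕ) (hℓ : 1 ≤ ℓ) :
    ∃ M₁ δ₀ C : ℝ, 0 < M₁ ∧ 0 < δ₀ ∧ 0 < C ∧
      ∀ i : KIdx d ℓ, (geoP i).Hyp21_22 → M₁ ≤ (geoP i).M → ∀ (m : Fin 4)
        (lam : (geoP i).Loc) (y y' : (geoP i).Site), (geoP i).suppIn lam y' →
          (gpP i).e m lam y ≤ C * pref4 ((geoP i).len y) m * Real.exp (-(δ₀ / 2 * (geoP i).dist y y')) *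
            (geoP i).supNorm lam := by
  obtain ⟨M₁, δ₀, C, hM₁, hδ₀, hC, h⟩ := prop22_supEntries_kLevel d ℓ hℓ
  refine ⟨M₁, δ₀, C, hM₁, hδ₀, hC, ?_⟩
  intro i hH hM m lam y y' hsupp
  have h' := h i hH hM m lam y y' hsupp
  change ((((nK i : ℕ) : ℝ))⁻¹) ^ (epow m) * i.gp.e m lam y
    ≤ C * pref4 (((ℓ : ℝ) + 1) ^ y.1.1 * (((nK i : ℕ) : ℝ))⁻¹) m * Real.exp (-(δ₀ / 2 * i.geo.dist y y')) * i.supF lam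
  have hlen : i.geo.len y = ((ℓ : ℝ) + 1) ^ y.1.1 := by rw [KIdx.geo_len, mul_one]
  rw [hlen] at h'
  rw [pref4_rescale]
  have hη : 0 ≤ ((((nK i : ℕ) : ℝ))⁻¹) ^ (epow m) := pow_nonneg (inv_nonneg.2 (nK_pos i).le) _
  calc ((((nK i : ℕ) : ℝ))⁻¹) ^ (epow m) * i.gp.e m lam y
      ≤ ((((nK i : ℕ) : ℝ))⁻¹) ^ (epow m) * (C * pref4 (((ℓ : ℝ) + 1) ^ y.1.1) m
          * Real.exp (-(δ₀ / 2 * i.geo.dist y y')) * i.supF lam) := mul_le_mul_of_nonneg_left h' hη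
    _ = _ := by ring

/-! ## §3 Hölder plumbing in print's units -/

section Plumbing

variable {ℓ : ℕ} (i : KIdx d ℓ)

/-- distinct lattice sites are at sup-distance `≥ 1`. [folklore] -/
private theorem one_le_supNorm_sub {a b : Fin (d + 1) → ℤ} (h : a ≠ b) : 1 ≤ supNorm (a - b) := by
  obtain ⟨j, hj⟩ : ∃ j, a j ≠ b j := by
    by_contra hc
    push Not at hc
    exact h (funext hc)
  have h1 : (1 : ℝ) ≤ (((|(a - b) j| : ℤ)) : ℝ) := by
    have : (1 : ℤ) ≤ |(a - b) j| := by
      rw [Pi.sub_apply]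
      exact Int.one_le_abs (sub_ne_zero.2 hj)
    exact_mod_cast this
  exact h1.trans (abs_le_supNorm (a - b) j)

/-- `0 ≤ ‖f‖_α`. [cite: Balaban1984PropagatorsII, Prop. 2.2 (2.67) p.234 («‖ζ‖_α»), dictionary] -/
theorem hqP_nonneg (α : ℝ) (f : ↥(i.XB) → ℝ) : 0 ≤ hqP i α f := by
  classical
  unfold hqP
  exact le_ciSup_of_le (Set.finite_range _).bddAbove (i.origin, i.origin) (by simp)

/-- one pair is bounded by the Hölder seminorm: `|f(x′) − f(x)|/(η|x′ − x|)^α ≤ ‖f‖_α`.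
[cite: Balaban1984PropagatorsII, Prop. 2.2 (2.67) p.234 («‖ζ‖_α»), dictionary] -/
theorem pair_le_hqP (α : ℝ) (f : ↥(i.XB) → ℝ) (x x' : ↥(i.XB)) (hne : x ≠ x') :
    |f x' - f x| / (supNorm (x'.1 - x.1) / (nK i)) ^ α ≤ hqP i α f := by
  classical
  unfold hqP
  have h := le_ciSup (Set.finite_range fun p : ↥(i.XB) × ↥(i.XB) =>
    if p.1 ≠ p.2 then |f p.2 - f p.1| / (supNorm (p.2.1 - p.1.1) / (nK i)) ^ α else 0).bddAbove (x, x')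
  simp only [ne_eq, hne, not_false_eq_true, if_true] at h
  exact h

/-- the pair quotient as a weighted value: `|v|/(|x′−x|/n)^α = (n/|x′−x|)^α·|v|` (`x′ ≠ x`).
[cite: Balaban1984PropagatorsI, (1.109) p.35, dictionary] -/
theorem quot_eq_weight (α : ℝ) (x x' : ↥(i.XB)) (hne : x'.1 ≠ x.1) (v : ℝ) :
    |v| / (supNorm (x'.1 - x.1) / (nK i)) ^ α
      = (((nK i : ℕ) : ℝ)) ^ α * (supNorm (x'.1 - x.1)) ^ (-α) * |v| := by
  have hs : 0 < supNorm (x'.1 - x.1) := lt_of_lt_of_le one_pos (one_le_supNorm_sub hne)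
  have hn : (0 : ℝ) < ((nK i : ℕ) : ℝ) := nK_pos i
  rw [Real.div_rpow hs.le hn.le, Real.rpow_neg hs.le]
  have h1 : 0 < supNorm (x'.1 - x.1) ^ α := Real.rpow_pos_of_pos hs α
  field_simp

/-- a bound of every pair quotient bounds the Hölder seminorm. [cite: Balaban1984PropagatorsII, Prop. 2.2 (2.67) p.234 («‖·‖_α»), dictionary] -/
theorem hqP_le_of_forall (α : ℝ) (f : ↥(i.XB) → ℝ) {Bd : ℝ} (h0 : 0 ≤ Bd)
    (h : ∀ x x' : ↥(i.XB), x ≠ x' → |f x' - f x| / (supNorm (x'.1 - x.1) / (nK i)) ^ α ≤ Bd) : hqP i α f ≤ Bd := by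
  classical
  unfold hqP
  refine ciSup_le fun p => ?_
  split_ifs with hne
  · exact h p.1 p.2 hne
  · exact h0

/-- a bound of every bond-pair quotient bounds the bond Hölder seminorm. [cite: Balaban1984PropagatorsII, Prop. 2.2 (2.67) p.234 («‖ζ∇G′λ‖_α»), dictionary] -/
theorem hqBP_le_of_forall (μ : Fin (d + 1)) (α : ℝ) (f : ↥(i.XB) → ℝ) {Bd : ℝ} (h0 : 0 ≤ Bd)
    (h : ∀ x x' : ↥(i.XB), x ≠ x' → x.1 + Pi.single μ 1 ∈ i.XB → x'.1 + Pi.single μ 1 ∈ i.XB →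
      |f x' - f x| / (supNorm (x'.1 - x.1) / (nK i)) ^ α ≤ Bd) : hqBP i μ α f ≤ Bd := by
  classical
  unfold hqBP
  refine ciSup_le fun p => ?_
  split_ifs with hc
  · exact h p.1 p.2 hc.1 hc.2.1 hc.2.2
  · exact h0

/-- a common bound of the `2(d+1)` dressed seminorms bounds the Hölder slot. [cite: Balaban1984PropagatorsII, Prop. 2.2 (2.67) p.234, dictionary] -/
theorem hHP_le_of_forall (f : ↥(i.XB) → ℝ) (α : ℝ) (ζ : ↥(i.XB) → ℝ) {Bd : ℝ}
    (hB : ∀ μ, hqBP i μ α (fun x => ζ x * dG i μ f x) ≤ Bd)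
    (hS : ∀ μ, hqP i α (fun x => ζ x * Gd i μ f x) ≤ Bd) : hHP i f α ζ ≤ Bd := by
  classical
  unfold hHP
  refine ciSup_le fun p => ?_
  rcases p with ⟨μ, b⟩
  cases b
  · simp only [Bool.false_eq_true, ↓reduceIte]; exact hS μ
  · simp only [↓reduceIte]; exact hB μ

/-- **THE PRODUCT RULE FOR ONE PAIR** of the `ζ`-dressed Hölder quotient (print's units), `supp ζ ⊂ B(y)`: if `|F| ≤ S` on
`B(y)` (at the two sites) and `|F(x′) − F(x)|/(η|x′−x|)^α ≤ H` when both sites lie in `B(y)`, then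
`|ζ(x′)F(x′) − ζ(x)F(x)|/(η|x′ − x|)^α ≤ ‖ζ‖_α·S + |ζ|·H`. [cite: Balaban1984PropagatorsII, Prop. 2.2 (2.67) p.234 («(‖ζ‖_α + |ζ|)»), dictionary] -/
theorem holder_pair_boundP (α : ℝ) (ζ F : ↥(i.XB) → ℝ) (y : ↥(bset i.D)) (hζ : ∀ w, ζ w ≠ 0 → blkOf i.D w = y)
    (x x' : ↥(i.XB)) (hne : x ≠ x') {S H : ℝ} (hS0 : 0 ≤ S) (hH0 : 0 ≤ H)
    (hSx : blkOf i.D x = y → |F x| ≤ S) (hSx' : blkOf i.D x' = y → |F x'| ≤ S)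
    (hH : blkOf i.D x = y → blkOf i.D x' = y → |F x' - F x| / (supNorm (x'.1 - x.1) / (nK i)) ^ α ≤ H) :
    |ζ x' * F x' - ζ x * F x| / (supNorm (x'.1 - x.1) / (nK i)) ^ α ≤ hqP i α ζ * S + i.supF ζ * H := by
  have hq0 := hqP_nonneg i α ζ
  have hz0 := supF_nonneg i ζ
  have hr : 0 < (supNorm (x'.1 - x.1) / (nK i)) ^ α := by
    have hne' : x'.1 ≠ x.1 := fun h => hne (Subtype.ext h).symm
    have hs : 0 < supNorm (x'.1 - x.1) := lt_of_lt_of_le one_pos (one_le_supNorm_sub hne')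
    exact Real.rpow_pos_of_pos (div_pos hs (nK_pos i)) α
  have hpair : |ζ x' - ζ x| / (supNorm (x'.1 - x.1) / (nK i)) ^ α ≤ hqP i α ζ := pair_le_hqP i α ζ x x' hne
  by_cases hx : blkOf i.D x = y
  · by_cases hx' : blkOf i.D x' = y
    · have e : ζ x' * F x' - ζ x * F x = ζ x' * (F x' - F x) + (ζ x' - ζ x) * F x := by ring
      rw [e]
      calc |ζ x' * (F x' - F x) + (ζ x' - ζ x) * F x| / (supNorm (x'.1 - x.1) / (nK i)) ^ α
          ≤ (|ζ x'| * |F x' - F x| + |ζ x' - ζ x| * |F x|) / (supNorm (x'.1 - x.1) / (nK i)) ^ α := by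
            refine div_le_div_of_nonneg_right ?_ hr.le
            calc _ ≤ |ζ x' * (F x' - F x)| + |(ζ x' - ζ x) * F x| := abs_add_le _ _
              _ = _ := by rw [abs_mul, abs_mul]
        _ = |ζ x'| * (|F x' - F x| / (supNorm (x'.1 - x.1) / (nK i)) ^ α)
            + |ζ x' - ζ x| / (supNorm (x'.1 - x.1) / (nK i)) ^ α * |F x| := by ring
        _ ≤ i.supF ζ * H + hqP i α ζ * S := by
            refine add_le_add ?_ ?_
            · exact mul_le_mul (abs_le_supF i ζ x') (hH hx hx') (by positivity) hz0
            · exact mul_le_mul hpair (hSx hx) (abs_nonneg _) hq0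
        _ = hqP i α ζ * S + i.supF ζ * H := by ring
    · have hz' : ζ x' = 0 := by by_contra h; exact hx' (hζ x' h)
      rw [hz', zero_mul, zero_sub, abs_neg, abs_mul]
      calc |ζ x| * |F x| / (supNorm (x'.1 - x.1) / (nK i)) ^ α
          = |ζ x' - ζ x| / (supNorm (x'.1 - x.1) / (nK i)) ^ α * |F x| := by rw [hz', zero_sub, abs_neg]; ring
        _ ≤ hqP i α ζ * S := mul_le_mul hpair (hSx hx) (abs_nonneg _) hq0
        _ ≤ hqP i α ζ * S + i.supF ζ * H := le_add_of_nonneg_right (by positivity)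
  · have hz : ζ x = 0 := by by_contra h; exact hx (hζ x h)
    by_cases hx' : blkOf i.D x' = y
    · rw [hz, zero_mul, sub_zero, abs_mul]
      calc |ζ x'| * |F x'| / (supNorm (x'.1 - x.1) / (nK i)) ^ α
          = |ζ x' - ζ x| / (supNorm (x'.1 - x.1) / (nK i)) ^ α * |F x'| := by rw [hz, sub_zero]; ring
        _ ≤ hqP i α ζ * S := mul_le_mul hpair (hSx' hx') (abs_nonneg _) hq0
        _ ≤ hqP i α ζ * S + i.supF ζ * H := le_add_of_nonneg_right (by positivity)
    · have hz' : ζ x' = 0 := by by_contra h; exact hx' (hζ x' h)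
      rw [hz, hz', zero_mul, zero_mul, sub_zero, abs_zero, zero_div]
      positivity

/-- the `η`-weight of the Hölder quotient against the block scale: `η·n^α·(L^j)^{1−α} = (L^j·η)^{1−α}` (`η = n⁻¹`).
[cite: Balaban1984PropagatorsII, (2.67) p.234 (the prefactor (L^jη)^{1−α}), dictionary] -/
theorem eta_weight {n t : ℝ} (hn : 0 < n) (ht : 0 ≤ t) (α : ℝ) :
    n⁻¹ * n ^ α * t ^ (1 - α) = (t * n⁻¹) ^ (1 - α) := by
  rw [Real.mul_rpow ht (inv_nonneg.2 hn.le), Real.inv_rpow hn.le, Real.rpow_sub hn, Real.rpow_one, inv_div]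
  ring

end Plumbing

/-! ## §4 The Hölder conjunct at each `α` on the genuine `k`-level family, in print's units -/

/-- **PROPOSITION 2.2 (2.67), THE HÖLDER ENTRIES 4 AND 5, IN THE CENSUS TYPING ON THE GENUINE `k`-LEVEL FAMILY (PRINT'S
UNITS), FOR EACH `α`** — the second conjunct of `B6.Prop22Printed (geoP) (gpP)` AT A FIXED `0 ≤ α < 1`: there are
`M₁, δ₀, C > 0` (depending on `d`, `L`, `α`) such that for EVERY nested family (2.1)–(2.2) on the box with `M = L·M_h ≥ M₁`,
every `λ` with `supp λ ⊂ B(y′)`, every cut-off `ζ` with `supp ζ ⊂ B(y)`: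
`max_μ max(‖ζ∇^η_μG′λ‖_α, ‖ζG′∇^{η*}_μλ‖_α) ≤ C·(L^jη)^{1−α}·(‖ζ‖_α + |ζ|)·e^{−½δ₀d(y,y′)}·|λ|`.  From p21's six-entry package
at this `α` — entries 2, 3 (`sup_{B(y)}|∇G′λ|, |G′∇*λ| = O(L^j)` lattice, `= O(L^jη)` print) and entries 4, 5 on the pairs of
one block (`O((L^j)^{1−α})` lattice, `O((L^jη)^{1−α})` print) — by the product rule `holder_pair_boundP`, with `L^jη ≤
(L^jη)^{1−α}` (`L^jη ≤ 1`, `len_le_one`) on the `‖ζ‖_α` term, exactly as in print.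
[cite: Balaban1984PropagatorsII, Prop. 2.2 (2.67) p.234 (entries 4, 5); (2.46) p.231; Balaban1983RegularityDecay, Thm (1.9) p.573] -/
theorem prop22_holderEntries_kLevelP (d ℓ : ℕ) (hℓ : 1 ≤ ℓ) (α : ℝ) (hα0 : 0 ≤ α) (hα1 : α < 1) :
    ∃ M₁ δ₀ C : ℝ, 0 < M₁ ∧ 0 < δ₀ ∧ 0 < C ∧
      ∀ i : KIdx d ℓ, (geoP i).Hyp21_22 → M₁ ≤ (geoP i).M →
        ∀ (lam : (geoP i).Loc) (ζ : (geoP i).Cut) (y y' : (geoP i).Site), (geoP i).cutIn ζ y → (geoP i).suppIn lam y' →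
          (gpP i).h1 lam α ζ ≤ C * ((geoP i).len y) ^ (1 - α) * (geoP i).cutH α ζ *
            Real.exp (-(δ₀ / 2 * (geoP i).dist y y')) * (geoP i).supNorm lam := by
  classical
  -- the windows of the printed weights
  set amin : ℝ := 1 - ((((ℓ : ℝ) + 1)) ^ 2)⁻¹ with hamin_def
  have hL2 : (1 : ℝ) < (((ℓ : ℝ) + 1)) ^ 2 := by
    have : (2 : ℝ) ≤ (ℓ : ℝ) + 1 := by
      have : (1 : ℝ) ≤ ℓ := by exact_mod_cast hℓ
      linarith
    nlinarith
  have hamin : 0 < amin := by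
    rw [hamin_def, sub_pos]
    exact inv_lt_one_of_one_lt₀ hL2
  obtain ⟨hwin, hrec⟩ := B6Prop22KLevelCensus.KIdx.aPrinted_windows hℓ
  -- p21's packages at this `α`: entries 2, 3 as majorants (sup of `F` on the blocks), entries 4, 5 on the pairs
  obtain ⟨δa, Ca, Ma, Na, hδa, hCa, hMa, hNa, hA⟩ :=
    prop22_six_multiLevelBox d ℓ hℓ amin 1 1 1 hamin one_pos α hα0 hα1
  obtain ⟨δb, Cb, Mb, Nb, hδb, hCb, hMb, hNb, hB⟩ :=
    prop22_six_pointwise_multiLevelBox d ℓ hℓ amin 1 1 1 hamin one_pos α hα0 hα1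
  set δ₀ : ℝ := min δa δb with hδ₀_def
  have hδ₀ : 0 < δ₀ := lt_min hδa hδb
  set CC : ℝ := Ca + Cb with hCC_def
  have hCC : 0 < CC := by positivity
  set M₁ : ℝ := max (max (max Ma Mb) (((max Na Nb : ℕ) : ℝ) + 1)) (3 * ((ℓ : ℝ) + 1)) with hM₁_def
  refine ⟨M₁, δ₀, CC, lt_of_lt_of_le hMa (le_trans (le_trans (le_max_left _ _) (le_max_left _ _)) (le_max_left _ _)),
    hδ₀, hCC, ?_⟩
  intro i _ hM lam ζ y y' hcut hsupp
  change ↥(i.XB) → ℝ at lam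
  change ↥(i.XB) → ℝ at ζ
  change ↥(bset i.D) at y
  change ↥(bset i.D) at y'
  change M₁ ≤ ((ℓ : ℝ) + 1) * i.Mh at hM
  change ∀ w, ζ w ≠ 0 → blkOf i.D w = y at hcut
  change ∀ x, lam x ≠ 0 → blkOf i.D x = y' at hsupp
  -- «M sufficiently large» for both packages
  have hMa' : Ma ≤ ((ℓ : ℝ) + 1) * i.Mh :=
    le_trans (le_trans (le_trans (le_max_left _ _) (le_max_left _ _)) (le_max_left _ _)) hM
  have hMb' : Mb ≤ ((ℓ : ℝ) + 1) * i.Mh :=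
    le_trans (le_trans (le_trans (le_max_right _ _) (le_max_left _ _)) (le_max_left _ _)) hM
  have hLpos : (0 : ℝ) < (ℓ : ℝ) + 1 := by positivity
  have hMh3 : 3 ≤ i.Mh := by
    have h3 : 3 * ((ℓ : ℝ) + 1) ≤ ((ℓ : ℝ) + 1) * i.Mh := le_trans (le_max_right _ _) hM
    have : (3 : ℝ) ≤ i.Mh := by nlinarith
    exact_mod_cast this
  have hMh1 : 1 ≤ i.Mh := le_trans (by norm_num) hMh3
  have hRM : ∀ N : ℕ, N ≤ max Na Nb → N + 1 ≤ i.R * ((ℓ + 1) * i.Mh) := by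
    intro N hN
    have h1 : (((max Na Nb : ℕ) : ℝ) + 1) ≤ ((ℓ : ℝ) + 1) * i.Mh :=
      le_trans (le_trans (le_max_right _ _) (le_max_left _ _)) hM
    have h2 : max Na Nb + 1 ≤ (ℓ + 1) * i.Mh := by exact_mod_cast h1
    have hR1 : 1 ≤ i.R := le_trans (by omega) i.hR
    calc N + 1 ≤ 1 * ((ℓ + 1) * i.Mh) := by rw [one_mul]; omega
      _ ≤ i.R * ((ℓ + 1) * i.Mh) := Nat.mul_le_mul_right _ hR1
  obtain ⟨-, h2, h3, -, -, -⟩ := hA i.k i.Mh i.R hMh3 hMa' i.hR (hRM Na (le_max_left _ _)) i.P i.hP i.D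
    (aPrinted ℓ 1) (fun _ => 1) hwin (fun j _ => ⟨le_rfl, le_rfl⟩) hrec
  have hpt := hB i.k i.Mh i.R hMh3 hMb' i.hR (hRM Nb (le_max_right _ _)) i.P i.hP i.D
    (aPrinted ℓ 1) (fun _ => 1) hwin (fun j _ => ⟨le_rfl, le_rfl⟩) hrec
  have hBS := i.blockSupp_of_suppIn lam y' hsupp
  -- the common shape of the target
  set n : ℝ := ((nK i : ℕ) : ℝ) with hn_def
  have hn : 0 < n := nK_pos i
  set t : ℝ := (geoP i).len y with ht_def
  have ht : t = ((ℓ : ℝ) + 1) ^ y.1.1 * n⁻¹ := geoP_len i y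
  have ht0 : 0 < t := len_pos i y
  have ht1 : t ≤ 1 := len_le_one i y
  have hLj0 : (0 : ℝ) ≤ ((ℓ : ℝ) + 1) ^ y.1.1 := by positivity
  set E : ℝ := Real.exp (-(δ₀ / 2 * (geoP i).dist y y')) with hE_def
  have hdist0 : 0 ≤ (geom i.D).dist y y' := by
    change (0 : ℝ) ≤ (((bond i.D).dist y y' : ℕ) : ℝ); exact Nat.cast_nonneg _
  have hEmono : ∀ δ : ℝ, δ₀ ≤ δ → Real.exp (-(δ / 2 * (geom i.D).dist y y')) ≤ E := by
    intro δ hδ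
    rw [hE_def]; apply Real.exp_le_exp.2
    change -(δ / 2 * (geom i.D).dist y y') ≤ -(δ₀ / 2 * (geom i.D).dist y y')
    have := mul_le_mul_of_nonneg_right (div_le_div_of_nonneg_right hδ (by norm_num : (0 : ℝ) ≤ 2)) hdist0
    linarith
  have hEa := hEmono δa (min_le_left _ _)
  have hEb := hEmono δb (min_le_right _ _)
  have hS0 := supF_nonneg i lam
  change hHP i lam α ζ ≤ CC * t ^ (1 - α) * (hqP i α ζ + i.supF ζ) * E * i.supF lam
  -- the common per-pair bound `B = CC·t^{1−α}·E·|λ|`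
  set B : ℝ := CC * t ^ (1 - α) * E * i.supF lam with hB_def
  have htα : 0 ≤ t ^ (1 - α) := Real.rpow_nonneg ht0.le _
  have hE0 : 0 ≤ E := (Real.exp_pos _).le
  have hB0 : 0 ≤ B := by positivity
  have ht_le : t ≤ t ^ (1 - α) := by
    have h := Real.rpow_le_rpow_of_exponent_ge ht0 ht1 (by linarith : 1 - α ≤ 1)
    rwa [Real.rpow_one] at h
  -- sup bounds (entries 2, 3): `|η·F(x)| ≤ Ca·L^jη·E·|λ| ≤ B` on `B(y)`
  have hCa_le : Ca ≤ CC := by rw [hCC_def]; linarith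
  have hCb_le : Cb ≤ CC := by rw [hCC_def]; linarith
  have sup_to_B : ∀ v : ℝ, |v| ≤ Ca * ((ℓ : ℝ) + 1) ^ y.1.1 * Real.exp (-(δa / 2 * (geom i.D).dist y y')) * i.supF lam →
      |n⁻¹ * v| ≤ B := by
    intro v hv
    rw [abs_mul, abs_of_pos (inv_pos.2 hn)]
    calc n⁻¹ * |v| ≤ n⁻¹ * (Ca * ((ℓ : ℝ) + 1) ^ y.1.1 * Real.exp (-(δa / 2 * (geom i.D).dist y y')) * i.supF lam) :=
          mul_le_mul_of_nonneg_left hv (inv_nonneg.2 hn.le)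
      _ = Ca * t * Real.exp (-(δa / 2 * (geom i.D).dist y y')) * i.supF lam := by rw [ht]; ring
      _ ≤ CC * t ^ (1 - α) * E * i.supF lam := by
          have h1 : Ca * t ≤ CC * t ^ (1 - α) := mul_le_mul hCa_le ht_le ht0.le hCC.le
          exact mul_le_mul (mul_le_mul h1 hEa (Real.exp_pos _).le (by positivity)) le_rfl hS0 (by positivity)
  -- pair bounds (entries 4, 5): `n^α·s^{−α}|F(x′)−F(x)|·η ≤ Cb·(L^jη)^{1−α}·E·|λ| ≤ B` on the pairs of `B(y)`
  have pair_to_B : ∀ (s v : ℝ), s ^ (-α) * |v| ≤ Cb * (((ℓ : ℝ) + 1) ^ y.1.1) ^ (1 - α)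
        * Real.exp (-(δb / 2 * (geom i.D).dist y y')) * i.supF lam →
      n ^ α * s ^ (-α) * |n⁻¹ * v| ≤ B := by
    intro s v hv
    rw [abs_mul, abs_of_pos (inv_pos.2 hn)]
    have hnα : 0 ≤ n ^ α := Real.rpow_nonneg hn.le _
    calc n ^ α * s ^ (-α) * (n⁻¹ * |v|) = n⁻¹ * n ^ α * (s ^ (-α) * |v|) := by ring
      _ ≤ n⁻¹ * n ^ α * (Cb * (((ℓ : ℝ) + 1) ^ y.1.1) ^ (1 - α)
          * Real.exp (-(δb / 2 * (geom i.D).dist y y')) * i.supF lam) :=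
          mul_le_mul_of_nonneg_left hv (by positivity)
      _ = Cb * (n⁻¹ * n ^ α * (((ℓ : ℝ) + 1) ^ y.1.1) ^ (1 - α))
          * Real.exp (-(δb / 2 * (geom i.D).dist y y')) * i.supF lam := by ring
      _ = Cb * t ^ (1 - α) * Real.exp (-(δb / 2 * (geom i.D).dist y y')) * i.supF lam := by
          rw [eta_weight hn hLj0 α, ← ht]
      _ ≤ CC * t ^ (1 - α) * E * i.supF lam :=
          mul_le_mul (mul_le_mul (mul_le_mul_of_nonneg_right hCb_le htα) hEb (Real.exp_pos _).le (by positivity))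
            le_rfl hS0 (by positivity)
  have hbound : hqP i α ζ * B + i.supF ζ * B = CC * t ^ (1 - α) * (hqP i α ζ + i.supF ζ) * E * i.supF lam := by
    rw [hB_def]; ring
  rw [← hbound]
  have hBB : 0 ≤ hqP i α ζ * B + i.supF ζ * B := by
    have := hqP_nonneg i α ζ; have := supF_nonneg i ζ; positivity
  refine hHP_le_of_forall i lam α ζ (fun μ => ?_) (fun μ => ?_)
  · -- entry 4: `ζ·∇^η_μG′λ`, bond pairs
    refine hqBP_le_of_forall i μ α _ hBB fun x x' hne hxm hxm' => ?_
    have hne' : x'.1 ≠ x.1 := fun h => hne (Subtype.ext h).symm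
    refine holder_pair_boundP i α ζ (dG i μ lam) y hcut x x' hne hB0 hB0 ?_ ?_ ?_
    · intro hx
      have h := h2 μ y' lam (i.supF lam) hBS x
      rw [Matrix.toLin'_apply, hx] at h
      simp only at h
      show |dG i μ lam x| ≤ B
      unfold dG
      rw [← i.dMat_G_mulVec]
      exact sup_to_B _ h
    · intro hx'
      have h := h2 μ y' lam (i.supF lam) hBS x'
      rw [Matrix.toLin'_apply, hx'] at h
      simp only at h
      show |dG i μ lam x'| ≤ B
      unfold dG
      rw [← i.dMat_G_mulVec]
      exact sup_to_B _ h
    · intro hx hx'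
      have hblk : blkOf i.D x' = blkOf i.D x := by rw [hx, hx']
      obtain ⟨h4, -⟩ := hpt μ y' lam (i.supF lam) hBS x x' hne' hblk
      have h4' := h4 hxm hxm'
      have hfx : fwd i.NB μ x = ⟨x.1 + Pi.single μ 1, hxm⟩ := Subtype.ext (fwd_val_of_mem μ x hxm)
      have hfx' : fwd i.NB μ x' = ⟨x'.1 + Pi.single μ 1, hxm'⟩ := Subtype.ext (fwd_val_of_mem μ x' hxm')
      rw [lev_eq_of_blkOf_eq i.D hx, hx] at h4'
      show |dG i μ lam x' - dG i μ lam x| / (supNorm (x'.1 - x.1) / (nK i)) ^ α ≤ B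
      rw [quot_eq_weight i α x x' hne']
      unfold dG
      rw [← mul_sub, hfx, hfx']
      exact pair_to_B _ _ h4'
  · -- entry 5: `ζ·G′∇^{η*}_μλ`, site pairs
    refine hqP_le_of_forall i α _ hBB fun x x' hne => ?_
    have hne' : x'.1 ≠ x.1 := fun h => hne (Subtype.ext h).symm
    have hds : dstar 1 μ i.G = i.G * (dMat i.NB μ)ᵀ := B6Prop22KLevelCensus.KIdx.dstar_one_eq μ i.G
    refine holder_pair_boundP i α ζ (Gd i μ lam) y hcut x x' hne hB0 hB0 ?_ ?_ ?_
    · intro hx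
      have h := h3 μ y' lam (i.supF lam) hBS x
      rw [Matrix.toLin'_apply, hx] at h
      simp only at h
      show |Gd i μ lam x| ≤ B
      unfold Gd
      rw [hds]
      exact sup_to_B _ h
    · intro hx'
      have h := h3 μ y' lam (i.supF lam) hBS x'
      rw [Matrix.toLin'_apply, hx'] at h
      simp only at h
      show |Gd i μ lam x'| ≤ B
      unfold Gd
      rw [hds]
      exact sup_to_B _ h
    · intro hx hx'
      have hblk : blkOf i.D x' = blkOf i.D x := by rw [hx, hx']
      obtain ⟨-, h5⟩ := hpt μ y' lam (i.supF lam) hBS x x' hne' hblk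
      rw [lev_eq_of_blkOf_eq i.D hx, hx] at h5
      show |Gd i μ lam x' - Gd i μ lam x| / (supNorm (x'.1 - x.1) / (nK i)) ^ α ≤ B
      rw [quot_eq_weight i α x x' hne']
      unfold Gd
      rw [← mul_sub, hds]
      exact pair_to_B _ _ h5

/-! ## §5 Both conjuncts of the census sentence at each `α`; non-vacuity -/

/-- **PROPOSITION 2.2 IN ITS CENSUS TYPING, AT EACH HÖLDER EXPONENT, ON THE GENUINE `k`-LEVEL FAMILY IN PRINT'S UNITS** —
the body of `B6.Prop22Printed (fun i : KIdx d ℓ => geoP i) (fun i => gpP i)` with the quantifier `∀ α` moved OUTSIDE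
(`∀ α ∈ [0,1) ∃ M₁ δ₀ C C_α`): ONE threshold and ONE rate for the four sup entries and the two Hölder entries at this `α`,
the printed prefactors `[(L^jη)², L^jη, L^jη, (L^jη)^{1−α}(‖ζ‖_α + |ζ|), (L^jη)^{1−α}(‖ζ‖_α + |ζ|), 1]`, the realised distance
(2.46), for EVERY nested family (2.1)–(2.2) of the box, every number of levels.  (`§2` + `§4`, rates by `min`, thresholds by
`max`.) [cite: Balaban1984PropagatorsII, Prop. 2.2 (2.67) p.234; (2.1)–(2.2) p.224; (2.46) p.231] -/
theorem prop22Printed_kLevelP_perAlpha (d ℓ : ℕ) (hℓ : 1 ≤ ℓ) (α : ℝ) (hα0 : 0 ≤ α) (hα1 : α < 1) :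
    ∃ M₁ δ₀ C Cα : ℝ, 0 < M₁ ∧ 0 < δ₀ ∧ 0 < C ∧
      ∀ i : KIdx d ℓ, (geoP i).Hyp21_22 → M₁ ≤ (geoP i).M →
        (∀ (m : Fin 4) (lam : (geoP i).Loc) (y y' : (geoP i).Site), (geoP i).suppIn lam y' →
            (gpP i).e m lam y ≤ C * pref4 ((geoP i).len y) m * Real.exp (-(δ₀ / 2 * (geoP i).dist y y')) *
              (geoP i).supNorm lam) ∧
        (∀ (lam : (geoP i).Loc) (ζ : (geoP i).Cut) (y y' : (geoP i).Site),
            (geoP i).cutIn ζ y → (geoP i).suppIn lam y' →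
            (gpP i).h1 lam α ζ ≤ Cα * ((geoP i).len y) ^ (1 - α) * (geoP i).cutH α ζ *
              Real.exp (-(δ₀ / 2 * (geoP i).dist y y')) * (geoP i).supNorm lam) := by
  obtain ⟨M₁, δ₁, C, hM₁, hδ₁, hC, hS⟩ := prop22_supEntries_kLevelP d ℓ hℓ
  obtain ⟨M₂, δ₂, Cα, hM₂, hδ₂, hCα, hH⟩ := prop22_holderEntries_kLevelP d ℓ hℓ α hα0 hα1
  refine ⟨max M₁ M₂, min δ₁ δ₂, C, Cα, lt_max_of_lt_left hM₁, lt_min hδ₁ hδ₂, hC, ?_⟩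
  intro i hHyp hM
  have hdist0 : ∀ y y' : (geoP i).Site, 0 ≤ (geoP i).dist y y' := by
    intro y y'
    change (0 : ℝ) ≤ (((bond i.D).dist y y' : ℕ) : ℝ); exact Nat.cast_nonneg _
  have hEmono : ∀ (δ : ℝ) (y y' : (geoP i).Site), min δ₁ δ₂ ≤ δ →
      Real.exp (-(δ / 2 * (geoP i).dist y y')) ≤ Real.exp (-(min δ₁ δ₂ / 2 * (geoP i).dist y y')) := by
    intro δ y y' hδ
    apply Real.exp_le_exp.2
    have := mul_le_mul_of_nonneg_right (div_le_div_of_nonneg_right hδ (by norm_num : (0 : ℝ) ≤ 2)) (hdist0 y y')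
    linarith
  have hsup0 : ∀ lam : (geoP i).Loc, 0 ≤ (geoP i).supNorm lam := fun lam => supF_nonneg i lam
  refine ⟨fun m lam y y' hsupp => ?_, fun lam ζ y y' hcut hsupp => ?_⟩
  · have h := hS i hHyp ((le_max_left _ _).trans hM) m lam y y' hsupp
    refine h.trans ?_
    have hp : 0 ≤ pref4 ((geoP i).len y) m := by
      have := (len_pos i y).le
      fin_cases m <;> simp [pref4] <;> positivity
    exact mul_le_mul_of_nonneg_right (mul_le_mul_of_nonneg_left (hEmono δ₁ y y' (min_le_left _ _)) (by positivity))
      (hsup0 lam)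
  · have h := hH i hHyp ((le_max_right _ _).trans hM) lam ζ y y' hcut hsupp
    refine h.trans ?_
    have hcut0 : 0 ≤ (geoP i).cutH α ζ := by
      change 0 ≤ hqP i α ζ + i.supF ζ
      have := hqP_nonneg i α ζ; have := supF_nonneg i ζ; positivity
    have hl : 0 ≤ ((geoP i).len y) ^ (1 - α) := Real.rpow_nonneg (len_pos i y).le _
    exact mul_le_mul_of_nonneg_right (mul_le_mul_of_nonneg_left (hEmono δ₂ y y' (min_le_right _ _)) (by positivity))
      (hsup0 lam)

/-- **NON-VACUITY beyond every threshold** (gen 12's witness read in print's units): for every `k ≥ 2` and every `M₁` the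
family has a member with `k` levels, `M ≥ M₁`, `Hyp21_22`, and blocks at BOTH top levels `k` and `k − 1`.
[cite: Balaban1984PropagatorsII, Prop. 2.2 p.234 («M is sufficiently large»); (2.1)–(2.2) p.224] -/
theorem kLevelP_nonvacuous (d ℓ k : ℕ) (hk : 2 ≤ k) (M₁ : ℝ) :
    ∃ i : KIdx d ℓ, i.k = k ∧ M₁ ≤ (geoP i).M ∧ (geoP i).Hyp21_22 ∧
      (∃ s : (geoP i).Site, (geoP i).scale s = k) ∧ (∃ s : (geoP i).Site, (geoP i).scale s = k - 1) :=
  kLevel_nonvacuous d ℓ k hk M₁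

end Literature.MathematicalPhysics.QuantumFieldTheory.Balaban1983to89.B6Prop22KLevelCensusEta
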